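import Mathlib
import Literature.Analysis.FluidPDE.VectorCalculus
import Summits.NavierStokesRegularity.NavierStokesRegularity.Theorems.ThreadingFluxErtelTowerKinematicRigidity
import Summits.NavierStokesRegularity.NavierStokesRegularity.Theorems.ThreadingFluxHorizonTowerZonalFrame
import HarnessLib

/-!
# Crux `PoloidalLiouville` (stmt-NavierStokesRegularity-1222, W1), crux idea «radial-jerk-tower» (ns-idea-15 g7):
# INVISCID LINEAR-FLOW RIGIDITY, I — the radial-jerk tower of a general linear drift `A(x − x₀)` and its discriminant

Support file (`--supports stmt-NavierStokesRegularity-1222`, helper).  Experiment cell `ns-wall-extremal`, width hand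
ns-wall-eng-5 g8, item (ε) «INVISCID LINEAR-FLOW RIGIDITY WITH SPIN».  0 kit.

`InviscidStrainRigidity` (p694495) treats the inviscid shadow of the wall at a stagnation centre whose velocity gradient is a
pure, triaxial STRAIN `S`.  At a general stagnation point the linearised drift is `u = A(x − x₀)` with an ARBITRARY
`A : ℝ³ →L[ℝ] ℝ³` (strain `S = ½(A + Aᵀ)` plus background vorticity `½ curl u = ω`, `A − S = [ω]×`).  This file computes the
first three levels of the radial-jerk tower of such a drift in closed form and reduces rigidity to ONE cubic form:

* `radialJerk_one_linear`: `θ₁ = ⟪A z, z⟫` (z = x − x₀);  `gradient_biQuad`: `∇⟪P z, N z⟫ = (P†N + N†P) z` for any `P, N`;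
  `radialJerk_two_linear`: `θ₂ = ⟪A z, (A + A†) z⟫`; hence
  `det(z, ∇θ₁, ∇θ₂) = ⟪z, (A + A†)z × (A†(A + A†) + (A + A†)A) z⟫ =: linDisc A z` (a cubic form in `z`, written out
  in each statement — no definition is introduced).
* `linDisc_line`: along every line the discriminant is a cubic polynomial in the parameter with leading coefficient
  `linDisc A v`; `cubic_leading_eq_zero`: a real cubic vanishing near `0` has zero leading coefficient; hence
  ★ `dense_linDisc_ne_zero`: if `linDisc A v ≠ 0` for ONE `v`, then `{z | linDisc A z ≠ 0}` is dense (no polynomial library).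
* ★ `linearFlowRigidity_of_ne_zero`: `inviscidKinematicRigidity` BY NAME ⇒ if `linDisc A v ≠ 0` for some `v`, every smooth field
  frozen into `u = A(x − x₀)` (`∂ₜB + DB[A(x−x₀)] − A B = 0`) on an open `I × U` and tangent to the spheres about `x₀` VANISHES.
* ★ `linearFlow_frozen_witness`: conversely, if `A` commutes with a rotation generator `z ↦ e × z` (i.e. the linear flow is
  axisymmetric about the axis `x₀ + ℝe`), then `B(x) = e × (x − x₀)` IS a steady frozen sphere-tangent field, non-zero when
  `e ≠ 0` — the `false-without-non-axisymmetric` witness of the inviscid linear-flow shadow.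

File II (`…LinearFlowRigidity`) evaluates the discriminant in an eigenframe of the strain and shows `linDisc A ≢ 0` whenever the
strain is triaxial — for EVERY background vorticity — so `InviscidStrainRigidity` survives spin.

HONEST FRAME: statements about the INVISCID LINEAR shadow (prescribed linear drift); helper/information-grade; W1 movement 0;
`PoloidalLiouville` (1222) / (27585) OPEN; NS regularity NOT proved.
-/

-- the summit and its single problem share the name (D-0017 nested layout)
set_option linter.dupNamespace false

noncomputable section

namespace Summit.NavierStokesRegularity.NavierStokesRegularity.Theorems.PoloidalLiouville.ErtelTower

open Set Function Filter Metric
open scoped Topology RealInnerProductSpace InnerProductSpace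
open Literature.Analysis.FluidPDE
open Summit.NavierStokesRegularity.NavierStokesRegularity.Theorems.PoloidalLiouville.HorizonTower (E3)
open Summit.NavierStokesRegularity.NavierStokesRegularity.Theorems.PoloidalLiouville.HorizonTower.Zonal (inner_cross_self_right)

/-! ### Gradients of bi-quadratic forms `⟪P(y − x₀), N(y − x₀)⟫` -/

section BiQuad

variable (P N : E3 →L[ℝ] E3) (x₀ : E3)

/-- `D(P(y − x₀))(x) = P` for a continuous linear `P`. -/
theorem hasFDerivAt_clm_sub (x : E3) : HasFDerivAt (fun y : E3 => P (y - x₀)) P x := by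
  rw [show (fun y : E3 => P (y - x₀)) = fun y => P y - P x₀ from funext fun y => map_sub P y x₀]
  exact P.hasFDerivAt.sub_const (P x₀)

/-- `D⟪P(y−x₀), N(y−x₀)⟫(x)[w] = ⟪P(x−x₀), N w⟫ + ⟪P w, N(x−x₀)⟫`. -/
theorem hasFDerivAt_biQuad (x : E3) :
    HasFDerivAt (fun y : E3 => ⟪P (y - x₀), N (y - x₀)⟫)
      ((innerSL ℝ (P (x - x₀))).comp N + (innerSL ℝ (N (x - x₀))).comp P) x := by
  refine ((hasFDerivAt_clm_sub P x₀ x).inner ℝ (hasFDerivAt_clm_sub N x₀ x)).congr_fderiv ?_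
  ext w
  simp only [ContinuousLinearMap.comp_apply, fderivInnerCLM_apply, ContinuousLinearMap.prod_apply,
    add_apply, innerSL_apply_apply, real_inner_comm (P w)]

/-- `∇⟪P(y−x₀), N(y−x₀)⟫(x) = (P†N + N†P)(x − x₀)`. -/
theorem gradient_biQuad (x : E3) :
    gradient (fun y : E3 => ⟪P (y - x₀), N (y - x₀)⟫) x =
      (ContinuousLinearMap.adjoint P) (N (x - x₀)) + (ContinuousLinearMap.adjoint N) (P (x - x₀)) := by
  apply ext_inner_right ℝ
  intro w
  rw [_root_.inner_gradient_left, (hasFDerivAt_biQuad P N x₀ x).fderiv, inner_add_left,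
    ContinuousLinearMap.adjoint_inner_left, ContinuousLinearMap.adjoint_inner_left]
  simp only [add_apply, ContinuousLinearMap.comp_apply, innerSL_apply_apply]
  ring

/-- The bi-quadratic form is smooth. -/
theorem contDiff_biQuad {n : WithTop ℕ∞} : ContDiff ℝ n (fun y : E3 => ⟪P (y - x₀), N (y - x₀)⟫) :=
  (P.contDiff.comp (contDiff_id.sub contDiff_const)).inner ℝ (N.contDiff.comp (contDiff_id.sub contDiff_const))

end BiQuad

/-! ### The tower of the linear drift `u = A(x − x₀)` -/

section Tower

variable (A : E3 →L[ℝ] E3) (x₀ : E3)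

/-- The linear drift is jointly smooth on every `I × U`. -/
theorem contDiffOn_linearDrift {n : WithTop ℕ∞} (I : Set ℝ) (U : Set E3) :
    ContDiffOn ℝ n (uncurry fun (_ : ℝ) (z : E3) => A (z - x₀)) (I ×ˢ U) :=
  (A.contDiff.comp (contDiff_snd.sub contDiff_const)).contDiffOn

/-- `D(A(y − x₀))(x) = A`. -/
theorem fderiv_linearDrift (x : E3) : fderiv ℝ (fun y : E3 => A (y - x₀)) x = A :=
  (hasFDerivAt_clm_sub A x₀ x).fderiv

/-- Level 1 of the tower of the linear drift: `θ₁ = ⟪A(x − x₀), x − x₀⟫`. -/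
theorem radialJerk_one_linear (t : ℝ) :
    radialJerk (fun (_ : ℝ) (z : E3) => A (z - x₀)) x₀ 1 t = fun x => ⟪A (x - x₀), x - x₀⟫ := by
  funext x
  rw [radialJerk_one]

/-- `∇θ₁ = (A + A†)(x − x₀)`. -/
theorem gradient_thetaOne_linear (x : E3) :
    gradient (fun y : E3 => ⟪A (y - x₀), y - x₀⟫) x = A (x - x₀) + (ContinuousLinearMap.adjoint A) (x - x₀) := by
  have h := gradient_biQuad A (ContinuousLinearMap.id ℝ E3) x₀ x
  simp only [ContinuousLinearMap.id_apply, ContinuousLinearMap.adjoint_id] at h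
  rw [h, add_comm]

/-- Level 2 of the tower of the linear drift: `θ₂ = ⟪A(x − x₀), (A + A†)(x − x₀)⟫`. -/
theorem radialJerk_two_linear (t : ℝ) :
    radialJerk (fun (_ : ℝ) (z : E3) => A (z - x₀)) x₀ 2 t =
      fun x => ⟪A (x - x₀), (A + ContinuousLinearMap.adjoint A) (x - x₀)⟫ := by
  funext x
  show deriv (fun s => radialJerk (fun (_ : ℝ) (z : E3) => A (z - x₀)) x₀ 1 s x) t
      + ⟪A (x - x₀), gradient (radialJerk (fun (_ : ℝ) (z : E3) => A (z - x₀)) x₀ 1 t) x⟫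
      = ⟪A (x - x₀), (A + ContinuousLinearMap.adjoint A) (x - x₀)⟫
  have hconst : (fun s : ℝ => radialJerk (fun (_ : ℝ) (z : E3) => A (z - x₀)) x₀ 1 s x)
      = fun _ => ⟪A (x - x₀), x - x₀⟫ := by
    funext s; rw [radialJerk_one_linear]
  rw [hconst, deriv_const, zero_add, radialJerk_one_linear, gradient_thetaOne_linear, add_apply]

/-- `∇θ₂ = (A†(A + A†) + (A + A†)A)(x − x₀)` (note `(A + A†)† = A + A†`). -/
theorem gradient_thetaTwo_linear (x : E3) :
    gradient (fun y : E3 => ⟪A (y - x₀), (A + ContinuousLinearMap.adjoint A) (y - x₀)⟫) x =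
      (ContinuousLinearMap.adjoint A) ((A + ContinuousLinearMap.adjoint A) (x - x₀))
        + (A + ContinuousLinearMap.adjoint A) (A (x - x₀)) := by
  rw [gradient_biQuad]
  congr 1
  rw [map_add (ContinuousLinearMap.adjoint), ContinuousLinearMap.adjoint_adjoint, add_comm]

/-- **The discriminant of the linear drift.**  At every time, the determinant `⟪x − x₀, ∇θ₁ × ∇θ₂⟫` of the first three
radial jerk gradients of `u = A(x − x₀)` is the cubic form
`⟪z, (A + A†)z × (A†(A + A†) + (A + A†)A) z⟫`, `z = x − x₀`. -/
theorem linDisc_eq (t : ℝ) (x : E3) :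
    ⟪x - x₀, cross (gradient (radialJerk (fun (_ : ℝ) (z : E3) => A (z - x₀)) x₀ 1 t) x)
        (gradient (radialJerk (fun (_ : ℝ) (z : E3) => A (z - x₀)) x₀ 2 t) x)⟫ =
      ⟪x - x₀, cross ((A + ContinuousLinearMap.adjoint A) (x - x₀))
        ((ContinuousLinearMap.adjoint A) ((A + ContinuousLinearMap.adjoint A) (x - x₀))
          + (A + ContinuousLinearMap.adjoint A) (A (x - x₀)))⟫ := by
  rw [radialJerk_one_linear, radialJerk_two_linear, gradient_thetaOne_linear, gradient_thetaTwo_linear,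
    add_apply]

end Tower

/-! ### A non-zero cubic form is non-zero on a dense set -/

section Cubic

/-- A real cubic `c₃t³ + c₂t² + c₁t + c₀` that vanishes for all `|t| < δ` has `c₃ = 0` (third difference at step `δ/4`). -/
theorem cubic_leading_eq_zero {c₀ c₁ c₂ c₃ δ : ℝ} (hδ : 0 < δ)
    (h : ∀ t : ℝ, |t| < δ → c₃ * t ^ 3 + c₂ * t ^ 2 + c₁ * t + c₀ = 0) : c₃ = 0 := by
  have h0 := h 0 (by simpa using hδ)
  have h1 := h (δ / 4) (by rw [abs_of_pos (by positivity)]; linarith)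
  have h2 := h (2 * (δ / 4)) (by rw [abs_of_pos (by positivity)]; linarith)
  have h3 := h (3 * (δ / 4)) (by rw [abs_of_pos (by positivity)]; linarith)
  -- third forward difference: `f(3s) − 3 f(2s) + 3 f(s) − f(0) = 6 c₃ s³`
  have key : 6 * c₃ * (δ / 4) ^ 3 = 0 := by linear_combination h3 - 3 * h2 + 3 * h1 - h0
  have hs : (δ / 4) ^ 3 ≠ 0 := by positivity
  have := mul_eq_zero.mp key
  rcases this with h6 | h6
  · linarith [h6]
  · exact absurd h6 hs

variable (M Q : E3 →L[ℝ] E3)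

/-- **The discriminant along a line is a cubic in the parameter** with leading coefficient its value at the direction:
`D(p + t v) = D(v) t³ + c₂ t² + c₁ t + D(p)` for `D(z) = ⟪z, M z × Q z⟫`. -/
theorem linDisc_line (p v : E3) : ∃ c₁ c₂ : ℝ, ∀ t : ℝ,
    ⟪p + t • v, cross (M (p + t • v)) (Q (p + t • v))⟫ =
      ⟪v, cross (M v) (Q v)⟫ * t ^ 3 + c₂ * t ^ 2 + c₁ * t + ⟪p, cross (M p) (Q p)⟫ := by
  refine ⟨⟪v, cross (M p) (Q p)⟫ + ⟪p, cross (M v) (Q p)⟫ + ⟪p, cross (M p) (Q v)⟫,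
    ⟪v, cross (M v) (Q p)⟫ + ⟪v, cross (M p) (Q v)⟫ + ⟪p, cross (M v) (Q v)⟫, fun t => ?_⟩
  simp only [map_add, map_smul, ← crossCLM_apply, add_apply, smul_apply,
    inner_add_left, inner_add_right, inner_smul_left, inner_smul_right, RCLike.conj_to_real]
  ring

/-- ★ **A cubic form that is non-zero somewhere is non-zero on a dense set**: if `⟪v, M v × Q v⟫ ≠ 0` for one `v`, then
`{z | ⟪z, M z × Q z⟫ ≠ 0}` is dense in `ℝ³` (if it missed a ball, the cubic `t ↦ D(p + t v)` would vanish near `t = 0`,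
forcing its leading coefficient `D(v)` to vanish). -/
theorem dense_linDisc_ne_zero {v : E3} (hv : ⟪v, cross (M v) (Q v)⟫ ≠ 0) :
    Dense {z : E3 | ⟪z, cross (M z) (Q z)⟫ ≠ 0} := by
  rw [dense_iff_inter_open]
  intro O hO ⟨p, hp⟩
  by_contra hempty
  rw [Set.not_nonempty_iff_eq_empty] at hempty
  -- `D` vanishes on `O`
  have hzero : ∀ z ∈ O, ⟪z, cross (M z) (Q z)⟫ = 0 := by
    intro z hz
    by_contra hne
    have : z ∈ O ∩ {z : E3 | ⟪z, cross (M z) (Q z)⟫ ≠ 0} := ⟨hz, hne⟩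
    rw [hempty] at this
    exact this
  obtain ⟨r, hr, hball⟩ := Metric.isOpen_iff.mp hO p hp
  obtain ⟨c₁, c₂, hline⟩ := linDisc_line M Q p v
  -- along the line `p + t v`, `|t| < r / (‖v‖ + 1)` stays in the ball
  have hδ : 0 < r / (‖v‖ + 1) := by positivity
  have hcubic : ∀ t : ℝ, |t| < r / (‖v‖ + 1) →
      ⟪v, cross (M v) (Q v)⟫ * t ^ 3 + c₂ * t ^ 2 + c₁ * t + ⟪p, cross (M p) (Q p)⟫ = 0 := by
    intro t ht
    rw [← hline t]
    apply hzero
    apply hball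
    rw [Metric.mem_ball, dist_eq_norm, add_sub_cancel_left, norm_smul, Real.norm_eq_abs]
    have hv1 : 0 < ‖v‖ + 1 := by positivity
    calc |t| * ‖v‖ ≤ |t| * (‖v‖ + 1) := by gcongr; linarith
      _ < r / (‖v‖ + 1) * (‖v‖ + 1) := by gcongr
      _ = r := div_mul_cancel₀ r hv1.ne'
  exact hv (cubic_leading_eq_zero hδ hcubic)

/-- Density survives the translation to the centre: `{x | D(x − x₀) ≠ 0}` is dense. -/
theorem dense_linDisc_ne_zero_sub (x₀ : E3) {v : E3} (hv : ⟪v, cross (M v) (Q v)⟫ ≠ 0) :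
    Dense {x : E3 | ⟪x - x₀, cross (M (x - x₀)) (Q (x - x₀))⟫ ≠ 0} := by
  have h := (dense_linDisc_ne_zero M Q hv).preimage (Homeomorph.subRight x₀).isOpenMap
  exact h

end Cubic

/-! ### Rigidity off the degenerate class, and the axisymmetric witness -/

section Rigidity

variable (A : E3 →L[ℝ] E3) (x₀ : E3)

/-- ★ **INVISCID LINEAR-FLOW RIGIDITY off the degenerate class** (`InviscidKinematicRigidity` BY NAME for the linear drift).
Let `u = A(x − x₀)` and suppose the discriminant cubic `⟪z, (A + A†)z × (A†(A + A†) + (A + A†)A)z⟫` is non-zero for ONE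
`z = v`.  Then every smooth field `B` frozen into `u` (`∂ₜB + DB[A(x − x₀)] − A B = 0`) on an open `I × U` and tangent to the
spheres about `x₀` vanishes identically — whatever the trace, the strain rates or the background vorticity of `A`. -/
theorem linearFlowRigidity_of_ne_zero (B : ℝ → E3 → E3) (I : Set ℝ) (U : Set E3) (hI : IsOpen I) (hU : IsOpen U)
    (hB : ContDiffOn ℝ (⊤ : ℕ∞) (uncurry B) (I ×ˢ U))
    (hfrozen : ∀ t ∈ I, ∀ x ∈ U, deriv (fun s => B s x) t + fderiv ℝ (B t) x (A (x - x₀)) - A (B t x) = 0)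
    (htan : ∀ t ∈ I, ∀ x ∈ U, ⟪B t x, x - x₀⟫ = 0) {v : E3}
    (hv : ⟪v, cross ((A + ContinuousLinearMap.adjoint A) v)
      ((ContinuousLinearMap.adjoint A) ((A + ContinuousLinearMap.adjoint A) v)
        + (A + ContinuousLinearMap.adjoint A) (A v))⟫ ≠ 0) :
    ∀ t ∈ I, ∀ x ∈ U, B t x = 0 := by
  set M : E3 →L[ℝ] E3 := A + ContinuousLinearMap.adjoint A with hM
  set Q : E3 →L[ℝ] E3 := (ContinuousLinearMap.adjoint A).comp M + M.comp A with hQ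
  have hQapply : ∀ z, Q z = (ContinuousLinearMap.adjoint A) (M z) + M (A z) := fun z => rfl
  have hv' : ⟪v, cross (M v) (Q v)⟫ ≠ 0 := by rw [hQapply]; exact hv
  have hdense := dense_linDisc_ne_zero_sub M Q x₀ hv'
  refine inviscidKinematicRigidity (fun (_ : ℝ) (z : E3) => A (z - x₀)) B x₀ I U hI hU (contDiffOn_linearDrift A x₀ I U) hB
    (fun t ht x hx => by rw [fderiv_linearDrift]; exact hfrozen t ht x hx) htan (fun t ht x hx => ?_)
  have hsub : U ∩ {x : E3 | ⟪x - x₀, cross (M (x - x₀)) (Q (x - x₀))⟫ ≠ 0} ⊆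
      {x | x ∈ U ∧ ⟪x - x₀, cross (gradient (radialJerk (fun (_ : ℝ) (z : E3) => A (z - x₀)) x₀ 1 t) x)
        (gradient (radialJerk (fun (_ : ℝ) (z : E3) => A (z - x₀)) x₀ 2 t) x)⟫ ≠ 0} := by
    rintro y ⟨hyU, hy⟩
    refine ⟨hyU, ?_⟩
    rw [Set.mem_setOf_eq, hQapply] at hy
    rw [linDisc_eq, ← hM]
    exact hy
  exact closure_mono hsub (hdense.open_subset_closure_inter hU hx)

/-- ★ **THE AXISYMMETRIC WITNESS** (`false-without-non-axisymmetric` for the inviscid linear-flow shadow).  If `A` commutes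
with the rotation generator `z ↦ e × z` — i.e. the linear flow `A(x − x₀)` is axisymmetric about the axis `x₀ + ℝe` — then
`B(x) = e × (x − x₀)` is a steady field FROZEN into `u = A(x − x₀)` (`DB[u] − A B = e × A z − A(e × z) = 0`) and tangent to the
spheres about `x₀`; it is non-zero off the axis when `e ≠ 0`. -/
theorem linearFlow_frozen_witness (e : E3) (hcomm : ∀ z : E3, A (cross e z) = cross e (A z)) :
    (∀ (t : ℝ) (x : E3), deriv (fun _ : ℝ => cross e (x - x₀)) t
        + fderiv ℝ (fun y : E3 => cross e (y - x₀)) x (A (x - x₀)) - A (cross e (x - x₀)) = 0) ∧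
    (∀ x : E3, ⟪cross e (x - x₀), x - x₀⟫ = 0) := by
  refine ⟨fun t x => ?_, fun x => inner_cross_self_right e (x - x₀)⟩
  have hlin : HasFDerivAt (fun y : E3 => cross e (y - x₀)) (crossCLM e) x := by
    have h := hasFDerivAt_clm_sub (crossCLM e) x₀ x
    simpa only [crossCLM_apply] using h
  rw [deriv_const, zero_add, hlin.fderiv, crossCLM_apply, hcomm, sub_self]

end Rigidity

end Summit.NavierStokesRegularity.NavierStokesRegularity.Theorems.PoloidalLiouville.ErtelTower

end
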